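import Summits.QuantumFields.YangMills.Theorems.BalabanUVNodesN15KingModelTorusHalfSpaces
import Summits.QuantumFields.YangMills.Theorems.BalabanUVNodesN15KingModelBlockFieldLawIdentification
import Summits.QuantumFields.YangMills.Theorems.BalabanUVNodesN19GaussianMarginal
import Literature.Probability.LatticeModels.GaussianFieldReflectionPositivityVector
import HarnessLib

/-!
# BalabanUVNodes ∕ N15 — THE KING-MODEL RUNG (PART Ϗ-b): KING's FINITE-VOLUME BLOCK-FIELD LAWS ARE REFLECTION POSITIVE ON THE TORUS —
# the fluctuation covariance `G_k = (c(−Δ)+m²+aQ*Q)⁻¹` (2.13), the law `N(0, S₂^{(K)})` of the block averages of the fine free field, and the RG block-field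
# laws `dμ^{(K)} = N(0, (Δ^{(K)})⁻¹)` (2.14) — NE2's UNIT-LAYER KERNEL OF THE MODEL (`blockCov`) — for the block-face reflection in EVERY direction with an
# even number of unit sites (Bałaban's volumes `2L^m`); by pushing part Ϗ-a through the block mean `Q`
# (Track A, DAG node N15 = NE2; FAN-OUT v1.1 §N15 s3 «KING-MODEL RUNG»; count-neutral)

HONEST FRAMING.  Count-neutral (cell `pub-ymgap`, seat `pub-ymgap-dag-n15-e` g37; `--supports stmt-QuantumFields-27366 --as helper` = K3⁸).  King's `A = 0`, `g = 0` model
([King1986] (2.10)–(2.14) pp.652–653, (4.1)–(4.5) p.670) on the unit torus `Π_μ ℤ∕M_μ` with fine torus `Π_μ ℤ∕(N·M_μ)`, `N = L^K`.  Reflection = dag-n15-a's block-face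
reflection `torRefl` (`x_κ ↦ −1 − x_κ`) on BOTH lattices (blocks go to blocks: dag-n15-d `blockOf_torRefl`); half torus `{val x_κ < M_κ∕2}` (unit) ∕ `{val x_κ < N·M_κ∕2}`
(fine) — the fine half IS the union of the blocks of the unit half (`mem_half_fine_iff`), so the block mean `Q` maps half-supported vectors to half-supported vectors and
INTERTWINES the two reflections (`transpose_Qmat_mulVec_comp_torRefl`); ★ `reflectedForm_blockAvg`: `Σ_{b,b′} w_b (QGQᵀ)(b,σb′) w_{b′} = Σ_{x,y} (Qᵀw)_x G(x,σy) (Qᵀw)_y` — the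
reflected form of a block-averaged kernel is the fine reflected form on the pulled-back vector (no property of `G` used).  CONSEQUENCES (all `M_κ` even, `m² > 0`):
★★ `kingFluctuation_isReflectionPositive` — King's fluctuation covariance `A₀⁻¹`, `A₀ = c(−Δ)+m²+a·Q*Q` (the propagator `G_k` of (2.13) up to `N^d`), is the covariance
of a reflection-positive Gaussian field on the fine torus (`Q*Q` never couples across the cut: `blockProj_apply_torRefl`); ★★★ **`fineBlockLaw_isReflectionPositive`** — the
law `N(0, S₂^{(K)})` of the block averages of the fine free field (part Ϝ-r∕u: `gaussLaw (fineBlockPrec) = gaussianFieldOfKernel S₂^{(K)}`) is reflection positive on all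
bounded half-torus observables; ★★★ **`blockFieldLaw_isReflectionPositive`** — KING's RG BLOCK-FIELD LAW `dμ^{(K)} = N(0, (Δ^{(K)})⁻¹)` (part Ϝ-v), whose covariance is the
rung's NE2 unit-layer kernel `blockCov` (g0), IS REFLECTION POSITIVE ON ALL BOUNDED HALF-TORUS OBSERVABLES, in every direction, for every `K ≥ 1`, `L ≥ 2`, `a > 0`, `m² > 0`,
by the PRECISION criterion applied to `Δ^{(K)} = a − a²N^dQA₀⁻¹Qᵀ` (its cut coupling is `−a²N^d ×` the fine reflected form of `A₀⁻¹` on `Qᵀw`, hence `≤ 0`);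
★★★ `blockFieldLaw_isReflectionPositive_kingVol` — on the King-model family's tori `Π ℤ∕(2L^m)` (even by construction) in EVERY direction.  NOT Bałaban's covariant
objects; NOT a node discharge; nothing continuum ∕ `ℝ⁴` ∕ OS axioms ∕ mass gap ∕ Clay.  0 `sorry`, 0 `def`.

WHAT THIS FILE PROVES (kernel).  §1 `mem_half_fine_iff`, `even_fine`, `Qmat_apply_eq`, `transpose_Qmat_mulVec_comp_torRefl`, `transpose_Qmat_mulVec_eq_zero`,
★ `reflectedForm_blockAvg`; §2 `blockProj_apply_torRefl`, `fineOp_apply_torRefl_of_ne`, `fineOp_apply_torRefl_self_nonpos`, `fineOp_cut_nonpos`, `fineOp_posDef`,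
★★ `fineOp_inv_reflected_nonneg`, ★★ `kingFluctuation_isReflectionPositive`; §3 `kingS2_torRefl`, ★★ `kingS2_reflected_nonneg`, `isPosSemidefKernel_kingS2`,
★★★ **`fineBlockLaw_isReflectionPositive`**, `fineBlockLaw_isReflectionPositive'` (density form); §4 `effLaplacian_cut_nonpos`, `effLaplacian_posDef`,
★★★ **`blockCov_reflection_positive`**, ★★★ **`blockFieldLaw_isReflectionPositive`**, `blockFieldLaw_isReflectionPositive'` (density form `gaussLaw (Δ^{(K)})`),
`blockFieldLaw_isReflectionInvariant`, ★★★ `blockFieldLaw_isReflectionPositive_kingVol`.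

Locators (use): [King1986] (2.6) p.652, (2.10)–(2.14) pp.652–653, (4.1)–(4.5) p.670, (4.41) p.675; Glimm–Jaffe 1987 §6.2 Thm. 6.2.2, §7.10 Thm. 7.10.3; FILS 1978 Thm. 2.1.
-/

noncomputable section

open scoped BigOperators
open Finset Matrix MeasureTheory

namespace Summit.QuantumFields.YangMills.BalabanUVNodes.N15KingModelRung.TorusRP

open Literature.MathematicalPhysics.QuantumFieldTheory (IsPosSemidefKernel gaussianFieldOfKernel)
open Literature.MathematicalPhysics.QuantumFieldTheory.Balaban1983to89.B5Prop11Plancherel (Tor fine unitVec)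
open Literature.MathematicalPhysics.QuantumFieldTheory.Balaban1983to89.QGQInverse (Coercive)
open Literature.MathematicalPhysics.QuantumFieldTheory.King1986 (aK aK_pos)
open Literature.MathematicalPhysics.QuantumFieldTheory.King1986.Torus (lapF lapF_comm lapF_coercive Qmat fineOp blockProj blockOf effLaplacian val_blockOf
  fineOp_coercive fineOp_transpose)
open Literature.Probability.LatticeModels (IsReflectionPositive IsReflectionPositiveReal IsReflectionInvariant
  reflectedCovariance_nonneg_of_precision reflectedCovariance_family_nonneg_of_precision gaussianField_isReflectionPositive_of_precision
  gaussianField_isReflectionInvariant_of_precision cut_nonpos_of_nearestNeighbour reflectedForm_eq_dotProduct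
  gaussianField_isReflectionPositive_of_vector gaussianField_isReflectionInvariant)
open Summit.QuantumFields.YangMills.BalabanUVNodes.N15.TwoGrid (torRefl torRefl_torRefl torRefl_apply_same torRefl_apply_ne torRefl_injective sum_torRefl)
open Summit.QuantumFields.YangMills.BalabanUVNodes.N15.KingModel.SrcDiv (val_torRefl_same lapF_torRefl blockOf_torRefl fineOp_torRefl fineOp_inv_torRefl)
open Summit.QuantumFields.YangMills.BalabanUVNodes.N15KingModelRung.Curved (Qmat_torRefl lapF_inv_torRefl effLaplacian_torRefl effLaplacian_inv_torRefl)
open Summit.QuantumFields.YangMills.BalabanUVNodes.N15KingModelRung.FreeField (gaussLaw gaussLaw_eq_gaussianFieldOfKernel isPosSemidefKernel_inv)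
open Summit.QuantumFields.YangMills.BalabanUVNodes.N19GaussianMarginal (posDef_of_coercive)

variable {d : ℕ}

/-! ## §1 Blocks and the cut: the fine half torus is the union of the blocks of the unit half torus; `Q` intertwines the reflections -/

section Blocks

variable (N : ℕ) [NeZero N] (M : Fin (d + 1) → ℕ) [∀ μ, NeZero (M μ)] (κ : Fin (d + 1))

/-- **The fine half torus is the union of the blocks of the unit half torus**: `val z_κ < N·M_κ∕2 ↔ val ⌊z∕N⌋_κ < M_κ∕2` (`M_κ` even).
[cite: King1986, (2.10) p.652] -/
theorem mem_half_fine_iff (hM : Even (M κ)) (z : Tor (fine N M)) :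
    (z κ).val < fine N M κ / 2 ↔ ((blockOf N M z) κ).val < M κ / 2 := by
  obtain ⟨m, hm⟩ := hM
  have hN : 0 < N := Nat.pos_of_ne_zero (NeZero.ne N)
  have h1 : fine N M κ / 2 = N * m := by
    show N * M κ / 2 = N * m
    rw [hm, ← two_mul, Nat.mul_left_comm, Nat.mul_div_cancel_left _ (by norm_num : 0 < 2)]
  have h2 : M κ / 2 = m := by omega
  rw [h1, h2, val_blockOf, Nat.div_lt_iff_lt_mul hN, mul_comm]

omit [NeZero N] [∀ μ, NeZero (M μ)] in
/-- The fine side `N·M_κ` is even when `M_κ` is. [folklore] -/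
theorem even_fine (hM : Even (M κ)) : Even (fine N M κ) := by
  show Even (N * M κ)
  exact hM.mul_left N

/-- `Q(b, z) = N^{−d}·[⌊z∕N⌋ = b]`. [cite: King1986, (2.10) p.652] -/
theorem Qmat_apply_eq (b : Tor M) (z : Tor (fine N M)) : Qmat N M b z = if blockOf N M z = b then ((N : ℝ) ^ (d + 1))⁻¹ else 0 := rfl

/-- **The block mean intertwines the unit and fine reflections**: `Qᵀ(w∘σ) = (Qᵀw)∘σ`. [cite: King1986, (2.10) p.652] -/
theorem transpose_Qmat_mulVec_comp_torRefl (w : Tor M → ℝ) :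
    ((Qmat N M)ᵀ *ᵥ fun b => w (torRefl M κ b)) = fun x => ((Qmat N M)ᵀ *ᵥ w) (torRefl (fine N M) κ x) := by
  funext x
  simp only [Matrix.mulVec, dotProduct, Matrix.transpose_apply]
  calc ∑ b, Qmat N M b x * w (torRefl M κ b)
      = ∑ b, Qmat N M (torRefl M κ b) x * w (torRefl M κ (torRefl M κ b)) :=
        (sum_torRefl (κ := κ) (fun b => Qmat N M b x * w (torRefl M κ b))).symm
    _ = ∑ b, Qmat N M b (torRefl (fine N M) κ x) * w b := Finset.sum_congr rfl fun b _ => by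
        rw [torRefl_torRefl, ← Qmat_torRefl N M κ b (torRefl (fine N M) κ x), torRefl_torRefl]

/-- A vector supported in the unit half torus pulls back under `Qᵀ` to a vector supported in the fine half torus (`M_κ` even). [cite: King1986, (2.10) p.652] -/
theorem transpose_Qmat_mulVec_eq_zero (hM : Even (M κ)) (w : Tor M → ℝ) (hw : ∀ b, b ∉ {b : Tor M | (b κ).val < M κ / 2} → w b = 0)
    (x : Tor (fine N M)) (hx : x ∉ {x : Tor (fine N M) | (x κ).val < fine N M κ / 2}) : ((Qmat N M)ᵀ *ᵥ w) x = 0 := by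
  simp only [Matrix.mulVec, dotProduct, Matrix.transpose_apply]
  refine Finset.sum_eq_zero fun b _ => ?_
  by_cases hb : blockOf N M x = b
  · have hb' : b ∉ {b : Tor M | (b κ).val < M κ / 2} := fun h => hx ((mem_half_fine_iff N M κ hM x).mpr (hb ▸ h))
    rw [hw b hb', mul_zero]
  · rw [Qmat_apply_eq, if_neg hb, zero_mul]

/-- ★ **THE BLOCK MEAN PUSHES REFLECTED FORMS DOWN TO THE FINE LATTICE**: for ANY fine matrix `G` and any unit vector `w`,
`Σ_{b,b′} w_b (QGQᵀ)(b, σb′) w_{b′} = Σ_{x,y} (Qᵀw)_x G(x, σy) (Qᵀw)_y`. [cite: King1986, (2.10)–(2.14) pp.652–653] [cite: GlimmJaffe1987, §7.10 Def. 7.10.2] -/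
theorem reflectedForm_blockAvg (G : Matrix (Tor (fine N M)) (Tor (fine N M)) ℝ) (w : Tor M → ℝ) :
    ∑ b, ∑ b', w b * (Qmat N M * G * (Qmat N M)ᵀ) b (torRefl M κ b') * w b'
      = ∑ x, ∑ y, ((Qmat N M)ᵀ *ᵥ w) x * G x (torRefl (fine N M) κ y) * ((Qmat N M)ᵀ *ᵥ w) y := by
  have h1 : ∑ b, ∑ b', w b * (Qmat N M * G * (Qmat N M)ᵀ) b (torRefl M κ b') * w b'
      = w ⬝ᵥ ((Qmat N M * G * (Qmat N M)ᵀ) *ᵥ fun b => w (torRefl M κ b)) :=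
    reflectedForm_eq_dotProduct (Qmat N M * G * (Qmat N M)ᵀ) (θ := Function.Involutive.toPerm (torRefl M κ) torRefl_torRefl) torRefl_torRefl w w
  have h2 : ∑ x, ∑ y, ((Qmat N M)ᵀ *ᵥ w) x * G x (torRefl (fine N M) κ y) * ((Qmat N M)ᵀ *ᵥ w) y
      = ((Qmat N M)ᵀ *ᵥ w) ⬝ᵥ (G *ᵥ fun y => ((Qmat N M)ᵀ *ᵥ w) (torRefl (fine N M) κ y)) :=
    reflectedForm_eq_dotProduct G (θ := Function.Involutive.toPerm (torRefl (fine N M) κ) torRefl_torRefl) torRefl_torRefl _ _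
  rw [h1, h2, ← Matrix.mulVec_mulVec, ← Matrix.mulVec_mulVec, transpose_Qmat_mulVec_comp_torRefl N M κ w, Matrix.dotProduct_mulVec,
    ← Matrix.mulVec_transpose]

end Blocks

/-! ## §2 King's fluctuation covariance `A₀⁻¹`, `A₀ = c(−Δ) + m² + a·Q*Q`, is reflection positive on the fine torus -/

section Fluctuation

variable (N : ℕ) [NeZero N] (M : Fin (d + 1) → ℕ) [∀ μ, NeZero (M μ)] (κ : Fin (d + 1))

/-- **`Q*Q` never couples across the cut**: `(Q*Q)(x, σy) = 0` for `x, y` in the fine half torus (their blocks lie in opposite unit halves; `M_κ` even).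
[cite: King1986, (4.1)–(4.3) p.670] -/
theorem blockProj_apply_torRefl (hM : Even (M κ)) {x y : Tor (fine N M)} (hx : (x κ).val < fine N M κ / 2) (hy : (y κ).val < fine N M κ / 2) :
    blockProj N M x (torRefl (fine N M) κ y) = 0 := by
  have hbx : ((blockOf N M x) κ).val < M κ / 2 := (mem_half_fine_iff N M κ hM x).mp hx
  have hby : ((blockOf N M y) κ).val < M κ / 2 := (mem_half_fine_iff N M κ hM y).mp hy
  have hne : blockOf N M x ≠ blockOf N M (torRefl (fine N M) κ y) := by
    rw [blockOf_torRefl]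
    exact fun h => ((torRefl_mem_half_iff κ hM (blockOf N M y)).mp (by rw [← h]; exact hbx)) hby
  simp only [blockProj, hne, if_false]

/-- `A₀(x, σy) = 0` for `x ≠ y` in the fine half torus. [cite: King1986, (4.1)–(4.5) p.670] [cite: GlimmJaffe1987, §7.10 Thm. 7.10.3] -/
theorem fineOp_apply_torRefl_of_ne (hM : Even (M κ)) (a c m2 : ℝ) {x y : Tor (fine N M)} (hx : (x κ).val < fine N M κ / 2)
    (hy : (y κ).val < fine N M κ / 2) (hxy : x ≠ y) : fineOp N M a c m2 x (torRefl (fine N M) κ y) = 0 := by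
  rw [fineOp, Matrix.add_apply, Matrix.smul_apply, lapF_apply_torRefl_of_ne κ (even_fine N M κ hM) c m2 hx hy hxy,
    blockProj_apply_torRefl N M κ hM hx hy, smul_zero, add_zero]

/-- `A₀(x, σx) ≤ 0` on the fine half torus (`c ≥ 0`). [cite: King1986, (4.1)–(4.5) p.670] -/
theorem fineOp_apply_torRefl_self_nonpos (hM : Even (M κ)) (a : ℝ) {c : ℝ} (hc : 0 ≤ c) (m2 : ℝ) {x : Tor (fine N M)}
    (hx : (x κ).val < fine N M κ / 2) : fineOp N M a c m2 x (torRefl (fine N M) κ x) ≤ 0 := by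
  rw [fineOp, Matrix.add_apply, Matrix.smul_apply, blockProj_apply_torRefl N M κ hM hx hx, smul_zero, add_zero]
  exact lapF_apply_torRefl_self_nonpos κ (even_fine N M κ hM) hc m2 hx

/-- ★ **King's `A₀` is ferromagnetic across the cut**: `Σ_{x,y} u_x A₀(x, σy) u_y ≤ 0` for `u` supported in the fine half torus (`M_κ` even, `c ≥ 0`).
[cite: King1986, (4.1)–(4.5) p.670] [cite: FILS1978, Thm. 2.1] -/
theorem fineOp_cut_nonpos (hM : Even (M κ)) (a : ℝ) {c : ℝ} (hc : 0 ≤ c) (m2 : ℝ) (u : Tor (fine N M) → ℝ)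
    (hu : ∀ x, x ∉ {x : Tor (fine N M) | (x κ).val < fine N M κ / 2} → u x = 0) :
    ∑ x, ∑ y, u x * fineOp N M a c m2 x ((Function.Involutive.toPerm (torRefl (fine N M) κ) torRefl_torRefl) y) * u y ≤ 0 :=
  cut_nonpos_of_nearestNeighbour (θ := Function.Involutive.toPerm (torRefl (fine N M) κ) torRefl_torRefl)
    (P := {x : Tor (fine N M) | (x κ).val < fine N M κ / 2})
    (fun _ hx _ hy hxy => fineOp_apply_torRefl_of_ne N M κ hM a c m2 hx hy hxy) (fun _ hx => fineOp_apply_torRefl_self_nonpos N M κ hM a hc m2 hx) u hu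

/-- `A₀` is positive definite (`a, c ≥ 0`, `m² > 0`). [cite: King1986, (4.1)–(4.5) p.670] -/
theorem fineOp_posDef {a c m2 : ℝ} (ha : 0 ≤ a) (hc : 0 ≤ c) (hm : 0 < m2) : (fineOp N M a c m2).PosDef :=
  posDef_of_coercive hm (fineOp_coercive N M m2 ha hc) (fineOp_transpose N M a c m2)

/-- ★★ **THE REFLECTED FORM OF KING's FLUCTUATION COVARIANCE IS NON-NEGATIVE**: `0 ≤ Σ_{x,y} u_x A₀⁻¹(x, σy) u_y` for `u` supported in the fine half torus
(`M_κ` even, `a, c ≥ 0`, `m² > 0`; precision criterion). [cite: King1986, (2.13) p.653, (4.5) p.670] [cite: GlimmJaffe1987, §7.10 Thm. 7.10.3] -/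
theorem fineOp_inv_reflected_nonneg (hM : Even (M κ)) {a c m2 : ℝ} (ha : 0 ≤ a) (hc : 0 ≤ c) (hm : 0 < m2) (u : Tor (fine N M) → ℝ)
    (hu : ∀ x, x ∉ {x : Tor (fine N M) | (x κ).val < fine N M κ / 2} → u x = 0) :
    0 ≤ ∑ x, ∑ y, u x * (fineOp N M a c m2)⁻¹ x (torRefl (fine N M) κ y) * u y :=
  reflectedCovariance_nonneg_of_precision (fineOp_posDef N M ha hc hm) (θ := Function.Involutive.toPerm (torRefl (fine N M) κ) torRefl_torRefl)
    torRefl_torRefl (fun x y => fineOp_torRefl κ N M a c m2 x y) (P := {x : Tor (fine N M) | (x κ).val < fine N M κ / 2})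
    (torRefl_mem_half_iff κ (even_fine N M κ hM)) (fineOp_cut_nonpos N M κ hM a hc m2) u hu

/-- ★★ **KING's FLUCTUATION COVARIANCE IS THE COVARIANCE OF A REFLECTION-POSITIVE GAUSSIAN FIELD**: `N(0, A₀⁻¹)`, `A₀ = c(−Δ)+m²+a·Q*Q` (King's (2.13)
propagator `G_k` up to the factor `N^d`), is reflection positive on all bounded fine half-torus observables (`M_κ` even, `a, c ≥ 0`, `m² > 0`).
[cite: King1986, (2.13) p.653, (4.5) p.670] [cite: GlimmJaffe1987, §7.10 Thm. 7.10.3, §6.2 Thm. 6.2.2] -/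
theorem kingFluctuation_isReflectionPositive (hM : Even (M κ)) {a c m2 : ℝ} (ha : 0 ≤ a) (hc : 0 ≤ c) (hm : 0 < m2) :
    IsReflectionPositive (gaussianFieldOfKernel fun x y : Tor (fine N M) => (fineOp N M a c m2)⁻¹ x y)
      (Function.Involutive.toPerm (torRefl (fine N M) κ) torRefl_torRefl) {x : Tor (fine N M) | (x κ).val < fine N M κ / 2} :=
  gaussianField_isReflectionPositive_of_precision (fineOp_posDef N M ha hc hm) (Function.Involutive.toPerm (torRefl (fine N M) κ) torRefl_torRefl)
    torRefl_torRefl (fun x y => fineOp_torRefl κ N M a c m2 x y) (torRefl_mem_half_iff κ (even_fine N M κ hM)) (fineOp_cut_nonpos N M κ hM a hc m2)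

end Fluctuation

/-! ## §3 The law `N(0, S₂^{(K)})` of the block averages of the fine free field is reflection positive -/

section BlockAverages

variable (N : ℕ) [NeZero N] (M : Fin (d + 1) → ℕ) [∀ μ, NeZero (M μ)] (κ : Fin (d + 1))

/-- `S₂^{(K)}(σb, σb′) = S₂^{(K)}(b, b′)`. [cite: King1986, (2.13)–(2.14) p.653] -/
theorem kingS2_torRefl (m2 : ℝ) (b b' : Tor M) : kingS2 N M m2 (torRefl M κ b) (torRefl M κ b') = kingS2 N M m2 b b' := by
  unfold kingS2
  congr 1
  exact Graph.mul_equiv₃ _ _ (torRefl M κ) (Function.Involutive.toPerm (torRefl (fine N M) κ) torRefl_torRefl) (torRefl M κ)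
    (fun b₁ y₁ => Graph.mul_equiv₃ _ _ (torRefl M κ) (Function.Involutive.toPerm (torRefl (fine N M) κ) torRefl_torRefl) (torRefl (fine N M) κ)
      (fun b₃ x₃ => Qmat_torRefl N M κ b₃ x₃) (fun x' y' => lapF_inv_torRefl κ (fine N M) _ m2 x' y') b₁ y₁)
    (fun y' b'' => by rw [Matrix.transpose_apply, Matrix.transpose_apply]; exact Qmat_torRefl N M κ b'' y') b b'

/-- ★★ **THE REFLECTED FORM OF `S₂^{(K)}` IS NON-NEGATIVE**: `0 ≤ Σ_{b,b′} w_b S₂^{(K)}(b, σb′) w_{b′}` for `w` supported in the unit half torus — it is `N^d` times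
the fine reflected form of `B⁻¹` on `Qᵀw` (part Ϗ-a). [cite: King1986, (2.13) p.653, Thm 2.1 (2.23) p.654] [cite: GlimmJaffe1987, §7.10 Thm. 7.10.3] -/
theorem kingS2_reflected_nonneg (hM : Even (M κ)) {m2 : ℝ} (hm : 0 < m2) (w : Tor M → ℝ)
    (hw : ∀ b, b ∉ {b : Tor M | (b κ).val < M κ / 2} → w b = 0) :
    0 ≤ ∑ b, ∑ b', w b * kingS2 N M m2 b (torRefl M κ b') * w b' := by
  have hfac : ∀ b b', w b * kingS2 N M m2 b (torRefl M κ b') * w b'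
      = (N : ℝ) ^ (d + 1) * (w b * (Qmat N M * (lapF (fine N M) ((N : ℝ) ^ 2) m2)⁻¹ * (Qmat N M)ᵀ) b (torRefl M κ b') * w b') := by
    intro b b'
    rw [kingS2]
    ring
  simp_rw [hfac, ← Finset.mul_sum]
  refine mul_nonneg (by positivity) ?_
  rw [reflectedForm_blockAvg N M κ]
  exact reflectedCovariance_nonneg_of_precision (lapF_posDef (by positivity) hm)
    (θ := Function.Involutive.toPerm (torRefl (fine N M) κ) torRefl_torRefl) torRefl_torRefl (fun x y => lapF_torRefl κ _ m2 x y)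
    (P := {x : Tor (fine N M) | (x κ).val < fine N M κ / 2}) (torRefl_mem_half_iff κ (even_fine N M κ hM))
    (lapF_cut_nonpos κ (even_fine N M κ hM) (by positivity) m2) _ (transpose_Qmat_mulVec_eq_zero N M κ hM w hw)

/-- `S₂^{(K)}` is a positive-semidefinite kernel (part Ϝ-u's `isPosSemidefKernel_inv` at the block precision `P_K = (S₂^{(K)})⁻¹`). [cite: King1986, (2.13) p.653] -/
theorem isPosSemidefKernel_kingS2 {m2 : ℝ} (hm : 0 < m2) : IsPosSemidefKernel (kingS2 N M m2) := by
  have h := isPosSemidefKernel_inv hm (coercive_fineBlockPrec M N hm) (fineBlockPrec_transpose M N m2)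
  rw [fineBlockPrec_inv M N hm] at h
  exact h

/-- ★★★ **THE LAW OF THE BLOCK AVERAGES OF KING's FINE FREE FIELD IS REFLECTION POSITIVE ON THE TORUS**: `N(0, S₂^{(K)})` is reflection positive on all bounded
observables measurable in the unit half-torus coordinates `{val b_κ < M_κ∕2}`, for the block-face reflection `σ_κ`, every direction `κ` with `M_κ` even (`m² > 0`).
[cite: King1986, (2.6) p.652, (2.13) p.653, Thm 2.1 (2.23) p.654] [cite: GlimmJaffe1987, §7.10 Thm. 7.10.3, §6.2 Thm. 6.2.2] [cite: FILS1978, Thm. 2.1] -/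
theorem fineBlockLaw_isReflectionPositive (hM : Even (M κ)) {m2 : ℝ} (hm : 0 < m2) :
    IsReflectionPositive (gaussianFieldOfKernel (kingS2 N M m2)) (Function.Involutive.toPerm (torRefl M κ) torRefl_torRefl)
      {b : Tor M | (b κ).val < M κ / 2} :=
  gaussianField_isReflectionPositive_of_vector (isPosSemidefKernel_kingS2 N M hm) (Function.Involutive.toPerm (torRefl M κ) torRefl_torRefl)
    (fun b b' => kingS2_torRefl N M κ m2 b b') torRefl_torRefl fun w hw => by
      refine (kingS2_reflected_nonneg N M κ hM hm w hw).trans_eq (Finset.sum_congr rfl fun b _ => Finset.sum_congr rfl fun b' _ => ?_)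
      show w b * kingS2 N M m2 b (torRefl M κ b') * w b' = w b * kingS2 N M m2 (torRefl M κ b) b' * w b'
      rw [← kingS2_torRefl N M κ m2 b (torRefl M κ b'), torRefl_torRefl]

/-- The same for the DENSITY-DEFINED law `ρ_{P_K}(φ)dφ` of part Ϝ-r (`gaussLaw (fineBlockPrec) = N(0, S₂^{(K)})`, part Ϝ-u). [cite: King1986, (2.6) p.652, (2.13) p.653] -/
theorem fineBlockLaw_isReflectionPositive' (hM : Even (M κ)) {m2 : ℝ} (hm : 0 < m2) :
    IsReflectionPositive (gaussLaw (fineBlockPrec M N m2)) (Function.Involutive.toPerm (torRefl M κ) torRefl_torRefl) {b : Tor M | (b κ).val < M κ / 2} := by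
  rw [fineBlockLaw_eq_gaussianFieldOfKernel M N hm]
  exact fineBlockLaw_isReflectionPositive N M κ hM hm

/-- `N(0, S₂^{(K)})` is reflection invariant. [cite: King1986, (2.13) p.653] -/
theorem fineBlockLaw_isReflectionInvariant {m2 : ℝ} (hm : 0 < m2) :
    IsReflectionInvariant (gaussianFieldOfKernel (kingS2 N M m2)) (Function.Involutive.toPerm (torRefl M κ) torRefl_torRefl) :=
  gaussianField_isReflectionInvariant (isPosSemidefKernel_kingS2 N M hm) _ (fun b b' => kingS2_torRefl N M κ m2 b b')

end BlockAverages

/-! ## §4 King's RG block-field law `dμ^{(K)} = N(0, (Δ^{(K)})⁻¹)` — NE2's unit-layer kernel of the model — is reflection positive -/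

section BlockField

variable (N : ℕ) [NeZero N] (M : Fin (d + 1) → ℕ) [∀ μ, NeZero (M μ)] (κ : Fin (d + 1))

/-- ★ **THE EFFECTIVE LAPLACIAN IS FERROMAGNETIC ACROSS THE CUT**: `Σ_{b,b′} w_b Δ^{(k)}(b, σb′) w_{b′} = −a²N^d·Σ_{x,y} (Qᵀw)_x A₀⁻¹(x,σy) (Qᵀw)_y ≤ 0` for `w`
supported in the unit half torus (`Δ^{(k)} = a − a²N^dQA₀⁻¹Qᵀ`; the identity never couples `b` to `σb′`; `M_κ` even, `a ≥ 0`, `c ≥ 0`, `m² > 0`).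
[cite: King1986, (2.14) p.653, (4.5) p.670] [cite: FILS1978, Thm. 2.1] -/
theorem effLaplacian_cut_nonpos (hM : Even (M κ)) {a c m2 : ℝ} (ha : 0 ≤ a) (hc : 0 ≤ c) (hm : 0 < m2) (w : Tor M → ℝ)
    (hw : ∀ b, b ∉ {b : Tor M | (b κ).val < M κ / 2} → w b = 0) :
    ∑ b, ∑ b', w b * effLaplacian N M a c m2 b ((Function.Involutive.toPerm (torRefl M κ) torRefl_torRefl) b') * w b' ≤ 0 := by
  have hone : ∀ b b', b' ∈ (Finset.univ : Finset (Tor M)) →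
      w b * (1 : Matrix (Tor M) (Tor M) ℝ) b (torRefl M κ b') * w b' = 0 := by
    intro b b' _
    by_cases hb : b ∈ {b : Tor M | (b κ).val < M κ / 2}
    · by_cases hb' : b' ∈ {b : Tor M | (b κ).val < M κ / 2}
      · rw [Matrix.one_apply_ne (torRefl_ne_of_mem_half κ hM hb hb').symm, mul_zero, zero_mul]
      · rw [hw b' hb', mul_zero]
    · rw [hw b hb, zero_mul, zero_mul]
  have hsplit : ∀ b b', w b * effLaplacian N M a c m2 b (torRefl M κ b') * w b'
      = a * (w b * (1 : Matrix (Tor M) (Tor M) ℝ) b (torRefl M κ b') * w b')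
        - (a ^ 2 * (N : ℝ) ^ (d + 1)) * (w b * (Qmat N M * (fineOp N M a c m2)⁻¹ * (Qmat N M)ᵀ) b (torRefl M κ b') * w b') := by
    intro b b'
    rw [effLaplacian, Matrix.sub_apply, Matrix.smul_apply, Matrix.smul_apply, smul_eq_mul, smul_eq_mul]
    ring
  show ∑ b, ∑ b', w b * effLaplacian N M a c m2 b (torRefl M κ b') * w b' ≤ 0
  simp_rw [hsplit, Finset.sum_sub_distrib, ← Finset.mul_sum]
  rw [Finset.sum_congr rfl fun b _ => Finset.sum_eq_zero (hone b), Finset.sum_const_zero, mul_zero, zero_sub, neg_nonpos,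
    reflectedForm_blockAvg N M κ]
  exact mul_nonneg (by positivity) (fineOp_inv_reflected_nonneg N M κ hM ha hc hm _ (transpose_Qmat_mulVec_eq_zero N M κ hM w hw))

variable (L : ℕ)

/-- `Δ^{(K)}` is positive definite on King's scales (`L ≥ 2`, `K ≥ 1`, `a_K = aK a L K`, `N = L^K`, `c = N²`, `a, m² > 0`; part Ϡ's uniform coercivity).
[cite: King1986, (2.14)–(2.16) p.653, (4.33) p.674] -/
theorem effLaplacian_posDef (hL : 2 ≤ L) {a m2 : ℝ} (ha : 0 < a) (hm : 0 < m2) {K : ℕ} (hK : 1 ≤ K) :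
    haveI : NeZero L := ⟨by omega⟩
    (effLaplacian (L ^ K) M (aK a L K) (((L ^ K : ℕ) : ℝ) ^ 2) m2).PosDef := by
  haveI : NeZero L := ⟨by omega⟩
  exact posDef_of_coercive (unifCoercive_pos L hL ha hm) (coercive_effLaplacian_unif L M hL ha hm hK) (effLaplacian_transpose_eq (L ^ K) M _ _ _)

/-- ★★★ **THE REFLECTED GRAM OF NE2's UNIT-LAYER KERNEL `(Δ^{(K)})⁻¹` IS POSITIVE SEMIDEFINITE ON THE HALF TORUS**: for every finite family `b_i` with
`val (b_i)_κ < M_κ∕2`, `0 ≤ Σ_{i,j} c_i c_j (Δ^{(K)})⁻¹(σ_κ b_i, b_j)` (`blockCov`; `L ≥ 2`, `K ≥ 1`, `a, m² > 0`, `M_κ` even).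
[cite: King1986, (2.14) p.653, (4.5) p.670, (4.41) p.675] [cite: GlimmJaffe1987, §7.10 Thm. 7.10.3] -/
theorem blockCov_reflection_positive (hL : 2 ≤ L) (hM : Even (M κ)) {a m2 : ℝ} (ha : 0 < a) (hm : 0 < m2) {K : ℕ} (hK : 1 ≤ K)
    (ι : Type) (s : Finset ι) (c : ι → ℝ) (b : ι → Tor M) (hb : ∀ i ∈ s, (b i κ).val < M κ / 2) :
    haveI : NeZero L := ⟨by omega⟩
    0 ≤ ∑ i ∈ s, ∑ j ∈ s, c i * c j * blockCov L (L ^ K) M a m2 K (torRefl M κ (b i)) (b j) := by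
  haveI : NeZero L := ⟨by omega⟩
  have hN2 : (0 : ℝ) ≤ ((L ^ K : ℕ) : ℝ) ^ 2 := by positivity
  exact reflectedCovariance_family_nonneg_of_precision (effLaplacian_posDef M L hL ha hm hK)
    (θ := Function.Involutive.toPerm (torRefl M κ) torRefl_torRefl) torRefl_torRefl (fun x y => effLaplacian_torRefl (L ^ K) M κ _ _ _ x y)
    (P := {b : Tor M | (b κ).val < M κ / 2}) (torRefl_mem_half_iff κ hM)
    (effLaplacian_cut_nonpos (L ^ K) M κ hM (aK_pos ha (by exact_mod_cast (show 1 < L by omega)) hK).le hN2 hm) ι s c b hb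

/-- ★★★ **KING's RG BLOCK-FIELD LAW `dμ^{(K)} = N(0, (Δ^{(K)})⁻¹)` IS REFLECTION POSITIVE ON THE TORUS**: on every unit torus `Π ℤ∕M_μ` and in every direction `κ` with
`M_κ` even, the Gaussian field of kernel `blockCov L (L^K) M a m² K = (Δ^{(K)})⁻¹` — the rung's NE2 UNIT-LAYER KERNEL — is reflection positive on ALL bounded observables
measurable in the half-torus block fields `{ψ(b) : val b_κ < M_κ∕2}` (`L ≥ 2`, `K ≥ 1`, `a, m² > 0`).
[cite: King1986, (2.6) p.652, (2.14) p.653, (4.5) p.670, (4.41) p.675] [cite: GlimmJaffe1987, §7.10 Thm. 7.10.3, §6.2 Thm. 6.2.2] [cite: FILS1978, Thm. 2.1] -/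
theorem blockFieldLaw_isReflectionPositive (hL : 2 ≤ L) (hM : Even (M κ)) {a m2 : ℝ} (ha : 0 < a) (hm : 0 < m2) {K : ℕ} (hK : 1 ≤ K) :
    haveI : NeZero L := ⟨by omega⟩
    IsReflectionPositive (gaussianFieldOfKernel (blockCov L (L ^ K) M a m2 K)) (Function.Involutive.toPerm (torRefl M κ) torRefl_torRefl)
      {b : Tor M | (b κ).val < M κ / 2} := by
  haveI : NeZero L := ⟨by omega⟩
  have hN2 : (0 : ℝ) ≤ ((L ^ K : ℕ) : ℝ) ^ 2 := by positivity
  exact gaussianField_isReflectionPositive_of_precision (effLaplacian_posDef M L hL ha hm hK)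
    (Function.Involutive.toPerm (torRefl M κ) torRefl_torRefl) torRefl_torRefl (fun x y => effLaplacian_torRefl (L ^ K) M κ _ _ _ x y)
    (torRefl_mem_half_iff κ hM) (effLaplacian_cut_nonpos (L ^ K) M κ hM (aK_pos ha (by exact_mod_cast (show 1 < L by omega)) hK).le hN2 hm)

/-- The same for the DENSITY-DEFINED law `ρ_{Δ^{(K)}}(ψ)dψ` (part Ϝ-v: `gaussLaw (Δ^{(K)}) = gaussianFieldOfKernel (blockCov K)`). [cite: King1986, (2.6) p.652, (2.14) p.653] -/
theorem blockFieldLaw_isReflectionPositive' (hL : 2 ≤ L) (hM : Even (M κ)) {a m2 : ℝ} (ha : 0 < a) (hm : 0 < m2) {K : ℕ} (hK : 1 ≤ K) :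
    haveI : NeZero L := ⟨by omega⟩
    IsReflectionPositive (gaussLaw (effLaplacian (L ^ K) M (aK a L K) (((L ^ K : ℕ) : ℝ) ^ 2) m2))
      (Function.Involutive.toPerm (torRefl M κ) torRefl_torRefl) {b : Tor M | (b κ).val < M κ / 2} := by
  haveI : NeZero L := ⟨by omega⟩
  have h := blockFieldLaw_eq_gaussianFieldOfKernel L M hL ha hm hK
  rw [h]
  exact blockFieldLaw_isReflectionPositive M κ L hL hM ha hm hK

/-- `dμ^{(K)}` is reflection invariant (every direction; no parity needed). [cite: King1986, (2.14) p.653, (4.5) p.670] -/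
theorem blockFieldLaw_isReflectionInvariant (hL : 2 ≤ L) {a m2 : ℝ} (ha : 0 < a) (hm : 0 < m2) {K : ℕ} (hK : 1 ≤ K) :
    haveI : NeZero L := ⟨by omega⟩
    IsReflectionInvariant (gaussianFieldOfKernel (blockCov L (L ^ K) M a m2 K)) (Function.Involutive.toPerm (torRefl M κ) torRefl_torRefl) := by
  haveI : NeZero L := ⟨by omega⟩
  exact gaussianField_isReflectionInvariant_of_precision (effLaplacian_posDef M L hL ha hm hK)
    (Function.Involutive.toPerm (torRefl M κ) torRefl_torRefl) (fun x y => effLaplacian_torRefl (L ^ K) M κ _ _ _ x y)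

/-- ★★★ **ON THE KING-MODEL FAMILY** (the rung's tori `Π ℤ∕(2L^m)`, even in every direction): for EVERY index `j` and EVERY direction `κ`, King's block-field law
`N(0, (Δ^{(K_j)})⁻¹)` is reflection positive on all bounded half-torus observables. [cite: King1986, (2.14) p.653, (4.41) p.675] [cite: GlimmJaffe1987, §7.10 Thm. 7.10.3] -/
theorem blockFieldLaw_isReflectionPositive_kingVol (hL : 2 ≤ L) {a m2 : ℝ} (ha : 0 < a) (hm : 0 < m2) (j : KingVolIndex d) (κ' : Fin (d + 1)) :
    haveI : NeZero L := ⟨by omega⟩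
    haveI := kingVol_neZero L j
    IsReflectionPositive (gaussianFieldOfKernel (blockCov L (L ^ j.K) (kingVol L j) a m2 j.K))
      (Function.Involutive.toPerm (torRefl (kingVol L j) κ') torRefl_torRefl) {b : Tor (kingVol L j) | (b κ').val < kingVol L j κ' / 2} := by
  haveI : NeZero L := ⟨by omega⟩
  haveI := kingVol_neZero L j
  exact blockFieldLaw_isReflectionPositive (kingVol L j) κ' L hL ⟨L ^ j.m, by simp [kingVol, two_mul]⟩ ha hm j.one_le_K

end BlockField

end Summit.QuantumFields.YangMills.BalabanUVNodes.N15KingModelRung.TorusRP
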